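import Summits.BirchSwinnertonDyer.Rank1Residual.P2.CMRankOneAtTwoHeegnerIndex
import HarnessLib

/-!
# Cell «bsd-cm», seat bsd-cm-two: the two HALVES of the `L`-free `2`-adic Heegner-index input —
# the IMC half and the Euler-system half as separate typed targets, with their consumers

HONEST FRAMING (cell «bsd-cm», `run/shared/lean/pub/bsd-cm/`, D-0033 tranche 1a; seat `bsd-cm-two`):
the target of record is FULL BSD for every analytic-rank `≤ 1` `E/ℚ` at every prime; the CM corner at
`p = 2` in analytic rank one (16 `openO12` cells) is OPEN in print. `P2/CMRankOneAtTwoHeegnerIndex.lean`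
typed its missing input as ONE `L`-free identity `ord₂ #Ш(E) = ord₂ 𝔮` (`CMRankOneHeegnerIndexAtTwo`).
The two proof technologies that exist at other primes each deliver ONE inequality: Iwasawa main
conjectures + descent give `ord₂ 𝔮 ≤ ord₂ #Ш(E)` (the cell's `MissingLowerBoundAt W 2`), Kolyvagin /
Euler systems give `ord₂ #Ш(E) ≤ ord₂ 𝔮` (`MissingUpperBoundAt W 2`; at ODD inert `p ≥ 5` this half is
PRINT — Kolyvagin 1990 / Matar–Nekovář 2019 Thm 0.3, `X12/InertCoreUpperHalf.lean`; at `2` Kolyvagin's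
ICM 1990 §2 gives only `[Ш(K,E)] ∣ C′²` with `C′ = C·`(a factor depending on `E`), so NEITHER half is
in print class-wide at `2`). This file types the halves separately (`@[conjecture]`, nothing asserted)
so that a future one-sided theorem has a kernel target and consumer. No arithmetic fact is asserted;
named published facts enter as explicit binders exactly as in the parent file. Nothing booked.

Contents: `CMRankOneHeegnerIndexLowerAtTwo` (IMC half), `CMRankOneHeegnerIndexUpperAtTwo`
(Euler-system half); `cmRankOneHeegnerIndexAtTwo_iff_halves` (the input is exactly the two halves);
`missingLowerBoundAt_two_of_lower` / `missingUpperBoundAt_two_of_upper` (each half gives the cell's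
typed half `MissingLowerBoundAt W 2` / `MissingUpperBoundAt W 2` for EVERY CM curve of analytic rank one,
granted the named facts); `cmCorner_of_halves` (both halves ⇒ the 16-cell corner).

References: [Kolyvagin1990] Thm A; Kolyvagin, Proc. ICM Kyoto 1990 §2; [MatarNekovar2019] Thm 0.3;
[BurungaleFlach2024] Thm 1.1, Cor. 2; [Miller2011LMS] Def 1.1; parent file `P2/CMRankOneAtTwoHeegnerIndex.lean`.
-/

noncomputable section

open scoped Classical

open WeierstrassCurve NumberField Literature.NumberTheory.EllipticCurves
  Literature.NumberTheory.EllipticCurves.ModularForms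
  Literature.NumberTheory.EllipticCurves.Rank1Residual
  Literature.NumberTheory.EllipticCurves.Rank1Residual.Typed

set_option autoImplicit false

namespace Summit.BirchSwinnertonDyer.Rank1Residual.P2

/-- **IMC HALF of the typed input** (`@[conjecture]`, nothing asserted): in the data of
`CMRankOneHeegnerIndexAtTwo`, `ord₂ 𝔮 ≤ ord₂ #Ш(E)` — the direction an Iwasawa main conjecture at `2`
over the CM field (Johnson-Leung–Kings Thm 5.2, in print for all `p`) PLUS a rank-one descent and a
`2`-adic Rubin/BDP formula at the non-split `2` (NOT in print) would give. OPEN.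
[cite: BurungaleFlach2024, p. 6 ("future work … analytic rank 1")] [cite: Miller2011LMS, Def. 1.1] -/
@[conjecture] def CMRankOneHeegnerIndexLowerAtTwo : Prop :=
  ∀ (W : WeierstrassCurve ℚ) [W.IsElliptic] [W.IsGloballyMinimal]
    (N : ℕ) [NeZero N] (K : Type) [Field K] [NumberField K]
    (Dt : ModularParametrizationData W N) (H : HeegnerDatum N (NumberField.discr K)) (ι : K →+* ℂ)
    (P : (W.baseChange K).toAffine.Point)
    (Wd : WeierstrassCurve ℚ) [Wd.IsElliptic] [Wd.IsGloballyMinimal] (Cd : VariableChange ℚ) (k : ℕ),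
    W.HasCM → W.analyticRank = 1 → IsImaginaryQuadratic K → SatisfiesHeegnerHypothesis N K →
    WeierstrassCurve.Affine.Point.map ι.toRatAlgHom P = heegnerPointComplex Dt H →
    (W.quadraticTwist (NumberField.discr K : ℚ)).entireLFunction 1 ≠ 0 →
    Cd • W.quadraticTwist (NumberField.discr K : ℚ) = Wd →
    (k = 1 ∨ k = 2) →
    (k = 2 ↔ ∀ y : W.toAffine.Point, ∃ Q : (W.baseChange K).toAffine.Point,
        QuadraticDescent.incl K W y - (2 : ℤ) • Q ∈
          AddCommGroup.torsion (W.baseChange K).toAffine.Point) →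
    padicValRat 2 (cmHeegnerIndexQuotient W K P Dt.c k Wd Cd.u) ≤ padicValNat 2 (Nat.card W.sha)

/-- **EULER-SYSTEM HALF of the typed input** (`@[conjecture]`, nothing asserted): in the same data,
`ord₂ #Ш(E) ≤ ord₂ 𝔮` — the direction Kolyvagin's method gives at odd primes with irreducible `E[p]`
(Kolyvagin 1990; Matar–Nekovář 2019 Thm 0.3, `p` odd); at `2` for CM curves only with an `E`-dependent
constant (Kolyvagin, ICM 1990 §2: `C′ = C·(…)`). OPEN as an exact statement.
[cite: Kolyvagin1990, Thm. A] [cite: MatarNekovar2019, Thm. 0.3 and §0.11] -/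
@[conjecture] def CMRankOneHeegnerIndexUpperAtTwo : Prop :=
  ∀ (W : WeierstrassCurve ℚ) [W.IsElliptic] [W.IsGloballyMinimal]
    (N : ℕ) [NeZero N] (K : Type) [Field K] [NumberField K]
    (Dt : ModularParametrizationData W N) (H : HeegnerDatum N (NumberField.discr K)) (ι : K →+* ℂ)
    (P : (W.baseChange K).toAffine.Point)
    (Wd : WeierstrassCurve ℚ) [Wd.IsElliptic] [Wd.IsGloballyMinimal] (Cd : VariableChange ℚ) (k : ℕ),
    W.HasCM → W.analyticRank = 1 → IsImaginaryQuadratic K → SatisfiesHeegnerHypothesis N K →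
    WeierstrassCurve.Affine.Point.map ι.toRatAlgHom P = heegnerPointComplex Dt H →
    (W.quadraticTwist (NumberField.discr K : ℚ)).entireLFunction 1 ≠ 0 →
    Cd • W.quadraticTwist (NumberField.discr K : ℚ) = Wd →
    (k = 1 ∨ k = 2) →
    (k = 2 ↔ ∀ y : W.toAffine.Point, ∃ Q : (W.baseChange K).toAffine.Point,
        QuadraticDescent.incl K W y - (2 : ℤ) • Q ∈
          AddCommGroup.torsion (W.baseChange K).toAffine.Point) →
    (padicValNat 2 (Nat.card W.sha) : ℤ) ≤ padicValRat 2 (cmHeegnerIndexQuotient W K P Dt.c k Wd Cd.u)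

/-- **The typed input is exactly the conjunction of its two halves** (`le_antisymm`). [folklore] -/
theorem cmRankOneHeegnerIndexAtTwo_iff_halves :
    CMRankOneHeegnerIndexAtTwo ↔
      CMRankOneHeegnerIndexLowerAtTwo ∧ CMRankOneHeegnerIndexUpperAtTwo := by
  constructor
  · intro h
    refine ⟨?_, ?_⟩
    · intro W _ _ N _ K _ _ Dt H ι P Wd _ _ Cd k hcm hr hK hHN hP hLt hWd hk12 hkiff
      exact (h W N K Dt H ι P Wd Cd k hcm hr hK hHN hP hLt hWd hk12 hkiff).le
    · intro W _ _ N _ K _ _ Dt H ι P Wd _ _ Cd k hcm hr hK hHN hP hLt hWd hk12 hkiff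
      exact (h W N K Dt H ι P Wd Cd k hcm hr hK hHN hP hLt hWd hk12 hkiff).ge
  · rintro ⟨hlo, hup⟩ W _ _ N _ K _ _ Dt H ι P Wd _ _ Cd k hcm hr hK hHN hP hLt hWd hk12 hkiff
    exact le_antisymm (hlo W N K Dt H ι P Wd Cd k hcm hr hK hHN hP hLt hWd hk12 hkiff)
      (hup W N K Dt H ι P Wd Cd k hcm hr hK hHN hP hLt hWd hk12 hkiff)

/-- **The IMC half gives the cell's typed half `MissingLowerBoundAt W 2` for EVERY CM curve of analytic
rank one** (granted Gross–Zagier, Kolyvagin, GZK, modularity, Burungale–Flach 2024, Waldspurger, parity,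
Heegner points over `K`: the auxiliary data exist as in the parent file's consumer).
[cite: Darmon2004, §3.9, proof of Thm. 3.22] [cite: BurungaleFlach2024, Thm. 1.1 and Cor. 2] -/
theorem missingLowerBoundAt_two_of_lower
    (hGZ : ∀ (N : ℕ) [NeZero N] (W : WeierstrassCurve ℚ) (K : Type) [Field K] [NumberField K],
      gross_zagier N W K)
    (hKo : ∀ (N : ℕ) [NeZero N] (W : WeierstrassCurve ℚ) (K : Type) [Field K] [NumberField K],
      kolyvagin N W K)
    (hGZK : rank_eq_analyticRank_of_analyticRank_le_one) (hmod : hasEntireLFunction_rat)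
    (hBF : bsdTriple_of_hasCM_of_L_one_ne_zero)
    (hWa : waldspurger_exists_heegnerField_twist_ne_zero)
    (hpar : ∀ W : WeierstrassCurve ℚ, W.even_analyticRank_iff)
    (hHP : ∀ (W : WeierstrassCurve ℚ) (K : Type) [Field K] [NumberField K], exists_isHeegnerPoint W K)
    (hlo : CMRankOneHeegnerIndexLowerAtTwo)
    (W : WeierstrassCurve ℚ) [W.IsElliptic] [W.IsGloballyMinimal] (hcm : W.HasCM)
    (hr : W.analyticRank = 1) : MissingLowerBoundAt W 2 := by
  have hw : W.rootNumber = -1 := by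
    rcases W.rootNumber_eq_one_or with hw | hw
    · exact absurd ((hpar W).mpr hw) (by rw [hr]; exact Nat.not_even_one)
    · exact hw
  obtain ⟨K, _, _, hKq, hH, hLt⟩ := hWa.exists W hw
  haveI : NeZero (W.conductorNorm ℤ) := ⟨(W.conductorNorm_pos_holds).ne'⟩
  obtain ⟨P, Dt, Hg, ι, hP⟩ := hHP W K hKq hH
  have hd : (NumberField.discr K : ℚ) ≠ 0 := by exact_mod_cast NumberField.discr_ne_zero K
  haveI := W.isElliptic_quadraticTwist hd
  obtain ⟨Cd, hCd⟩ := hasGlobalMinimalModel_rat_holds (W.quadraticTwist (NumberField.discr K : ℚ))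
  haveI := hCd
  obtain ⟨k, hk12, hkiff, hloiff, -⟩ := missingHalves_two_iff_cmHeegnerIndex W (W.conductorNorm ℤ) K
    Dt Hg ι P (hGZ _ W K) (hKo _ W K) hGZK hmod hBF hcm hKq hH hP hr hLt
    (Cd • W.quadraticTwist (NumberField.discr K : ℚ)) Cd rfl
  exact hloiff.mpr (hlo W (W.conductorNorm ℤ) K Dt Hg ι P _ Cd k hcm hr hKq hH hP hLt rfl hk12 hkiff)

/-- **The Euler-system half gives the cell's typed half `MissingUpperBoundAt W 2` for EVERY CM curve of
analytic rank one** (same named facts). [cite: Kolyvagin1990, Thm. A] [cite: Darmon2004, §3.9] -/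
theorem missingUpperBoundAt_two_of_upper
    (hGZ : ∀ (N : ℕ) [NeZero N] (W : WeierstrassCurve ℚ) (K : Type) [Field K] [NumberField K],
      gross_zagier N W K)
    (hKo : ∀ (N : ℕ) [NeZero N] (W : WeierstrassCurve ℚ) (K : Type) [Field K] [NumberField K],
      kolyvagin N W K)
    (hGZK : rank_eq_analyticRank_of_analyticRank_le_one) (hmod : hasEntireLFunction_rat)
    (hBF : bsdTriple_of_hasCM_of_L_one_ne_zero)
    (hWa : waldspurger_exists_heegnerField_twist_ne_zero)
    (hpar : ∀ W : WeierstrassCurve ℚ, W.even_analyticRank_iff)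
    (hHP : ∀ (W : WeierstrassCurve ℚ) (K : Type) [Field K] [NumberField K], exists_isHeegnerPoint W K)
    (hup : CMRankOneHeegnerIndexUpperAtTwo)
    (W : WeierstrassCurve ℚ) [W.IsElliptic] [W.IsGloballyMinimal] (hcm : W.HasCM)
    (hr : W.analyticRank = 1) : MissingUpperBoundAt W 2 := by
  have hw : W.rootNumber = -1 := by
    rcases W.rootNumber_eq_one_or with hw | hw
    · exact absurd ((hpar W).mpr hw) (by rw [hr]; exact Nat.not_even_one)
    · exact hw
  obtain ⟨K, _, _, hKq, hH, hLt⟩ := hWa.exists W hw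
  haveI : NeZero (W.conductorNorm ℤ) := ⟨(W.conductorNorm_pos_holds).ne'⟩
  obtain ⟨P, Dt, Hg, ι, hP⟩ := hHP W K hKq hH
  have hd : (NumberField.discr K : ℚ) ≠ 0 := by exact_mod_cast NumberField.discr_ne_zero K
  haveI := W.isElliptic_quadraticTwist hd
  obtain ⟨Cd, hCd⟩ := hasGlobalMinimalModel_rat_holds (W.quadraticTwist (NumberField.discr K : ℚ))
  haveI := hCd
  obtain ⟨k, hk12, hkiff, -, hupiff⟩ := missingHalves_two_iff_cmHeegnerIndex W (W.conductorNorm ℤ) K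
    Dt Hg ι P (hGZ _ W K) (hKo _ W K) hGZK hmod hBF hcm hKq hH hP hr hLt
    (Cd • W.quadraticTwist (NumberField.discr K : ℚ)) Cd rfl
  exact hupiff.mpr (hup W (W.conductorNorm ℤ) K Dt Hg ι P _ Cd k hcm hr hKq hH hP hLt rfl hk12 hkiff)

/-- **Both halves ⇒ the whole CM corner at `2`** (`CMNonsplitRankOneAtTwo ∧ LTYZPotentiallyGoodOrdinaryAtTwo`,
16 cells), through the parent file's consumer. [cite: BurungaleFlach2024, Thm. 1.1 and Cor. 2] [cite: Miller2011LMS, Def. 1.1] -/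
theorem cmCorner_of_halves
    (hGZ : ∀ (N : ℕ) [NeZero N] (W : WeierstrassCurve ℚ) (K : Type) [Field K] [NumberField K],
      gross_zagier N W K)
    (hKo : ∀ (N : ℕ) [NeZero N] (W : WeierstrassCurve ℚ) (K : Type) [Field K] [NumberField K],
      kolyvagin N W K)
    (hGZK : rank_eq_analyticRank_of_analyticRank_le_one) (hmod : hasEntireLFunction_rat)
    (hBF : bsdTriple_of_hasCM_of_L_one_ne_zero)
    (hWa : waldspurger_exists_heegnerField_twist_ne_zero)
    (hpar : ∀ W : WeierstrassCurve ℚ, W.even_analyticRank_iff)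
    (hHP : ∀ (W : WeierstrassCurve ℚ) (K : Type) [Field K] [NumberField K], exists_isHeegnerPoint W K)
    (hlo : CMRankOneHeegnerIndexLowerAtTwo) (hup : CMRankOneHeegnerIndexUpperAtTwo) :
    CMNonsplitRankOneAtTwo ∧ LTYZPotentiallyGoodOrdinaryAtTwo :=
  cmCorner_of_heegnerIndexAtTwo hGZ hKo hGZK hmod hBF hWa hpar hHP
    (cmRankOneHeegnerIndexAtTwo_iff_halves.mpr ⟨hlo, hup⟩)

end Summit.BirchSwinnertonDyer.Rank1Residual.P2

end
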